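import Literature.NumberTheory.EllipticCurves.KuriharaNumber
import Literature.NumberTheory.EllipticCurves.ModularCurve
import Literature.NumberTheory.EllipticCurves.Sha
import Literature.NumberTheory.EllipticCurves.PAdicLFunction
import HarnessLib

/-!
# Kim's mod-`p` rank certificate by Kurihara numbers (C.-H. Kim 2022, Thm. 1.11 with Cor. 1.6)

Topic `NumberTheory/EllipticCurves`; namespace `Literature.NumberTheory.EllipticCurves`. One named
fact (`def … : Prop`, D-0014), consumed by route `LeadingTerm` of BSD (crux `TamePinchR`,
stmt-BirchSwinnertonDyer-17007: `Summits/…/Theorems/LeadingTermTamePinchR.lean`,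
`tamePinchR_of_facts`) and usable by the sibling crux lines (`kim-chebotarev-peeling`).

## The printed statements (C.-H. Kim, *The structure of Selmer groups and the Iwasawa main conjecture
for elliptic curves*, arXiv:2203.12159 = Amer. J. Math.; held text, PDF pp. 4–8)

* §1.2.2 (p. 5): `𝒫_k = {ℓ prime : (ℓ, Np) = 1, ℓ ≡ 1 (mod p^k), a_ℓ(E) ≡ ℓ + 1 (mod p^k)}`,
  `𝒩_k` = square-free products of primes in `𝒫_k` (`1 ∈ 𝒩_k`).
* §1.4.1–1.4.3 (p. 7): for `p ≥ 5`, `ρ̄` irreducible and the Manin constant prime to `p`, the modular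
  symbols `[r]⁺` defined by `2π ∫₀^∞ f(r + iy) dy = [r]⁺ Ω⁺_E + [r]⁻ √-1 Ω⁻_E`, "the real Néron period
  `Ω⁺_E` of `E` is taken as the absolute value of the integral of an invariant differential of a
  global minimal Weierstrass model of `E` over `E(ℝ)`", are `p`-integral; the mod-`I_n` Kurihara
  number is `δ̃_n = ∑_{a ∈ (ℤ/n)ˣ} \overline{[a/n]⁺} · ∏_{ℓ∣n} \overline{log_{η_ℓ}(a)}`, "well-defined up
  to `(ℤ_p/I_nℤ_p)ˣ`"; `ν(n)` = number of prime factors; `ord(δ̃) = min{ν(n) : n ∈ 𝒩₁, δ̃_n ≠ 0}`.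
* THEOREM 1.11 (p. 8). "Let `E` be an elliptic curve over `ℚ` and `p ≥ 5` a prime such that
  (i) `ρ̄` is surjective, (ii) the Manin constant is prime to `p`, (iii) `E(ℚ_p)[p] = 0`, and (iv) all
  the Tamagawa factors are prime to `p`. Then the following statements are equivalent.
  (1) `δ̃⁽¹⁾_n ≠ 0` in `𝔽_p` for some `n ∈ 𝒩₁` with `ν(n) = ord(δ̃⁽¹⁾)`. (2) The mod `p` Kato's
  Kolyvagin system `κ^{Kato,(1)}` is non-trivial. (3) [the cyclotomic Iwasawa main identity for
  `E` at `p`, Kim's `(IMC)`, statement 1.3] holds. …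
  If we further assume that `Ш(E/ℚ)[p]` is trivial, then we have a mod `p` exact rank formula
  `rk_ℤ E(ℚ) = ord(δ̃⁽¹⁾) = ν(n)`."
* COROLLARY 1.5/1.6, §1.2.5, §1.1.3 (pp. 4–6): "Since the [IMC] inverting `p` for elliptic curves
  with good ordinary reduction at `p` is established under our setting [Kato 2004, Skinner–Urban
  2014, Wan] …" — at a good ORDINARY `p ≥ 5` with `ρ̄` surjective statement (3) is a THEOREM (see
  "Status of statement (3)" below for the precise chain), so (1) holds; with `Ш(E/ℚ)[p] = 0` this
  gives `n ∈ 𝒩₁` with `ν(n) = rk_ℤ E(ℚ)` and `δ̃⁽¹⁾_n ≠ 0 (mod p)`.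

## Status of statement (3) at a good ordinary prime (provenance audit, 2026-08-16)

Statement (3) of Thm. 1.11 is the paper's Conjecture 1.3 (IMC) — Kato's main conjecture without
`p`-adic `L`-functions, `char_Λ(H¹_Iw(ℚ, T)/Λκ₁^{Kato,∞}) = char_Λ(Sel₀(ℚ_∞, E[p^∞])^∨)` as ideals
of `Λ` (§1.2.4, p. 5) — in FULL, not "inverting `p`": the paper's footnote 2 (p. 2) reads "The
meaning of 'inverting `p`' here is 'up to `μ`-invariants'", and in the mod-`p` situation of
Thm. 1.11 the `μ`-part is exactly what is at stake (§6, proof of Thm. 1.11, p. 31: `KS(T ⊗ Λ)` is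
free of rank one over `Λ` (Büyükboduk, Thm. 6.1); comparing `κ^{Kato,∞}` with a generator
`κ^{prim,∞}` by a scalar `f ∈ Λ`, "the Iwasawa main conjecture is equivalent to `f ∈ Λˣ`", while
the version inverting `p` only places `f` in `p^ℤ · Λˣ`). What the paper invokes for good
ordinary `p` (§1.1.3, p. 4; Cor. 1.5–1.6, p. 6) is Mazur's main conjecture
`char_Λ X(E/ℚ_∞) = (L_p(E))`, between whose formulation (Kato 2004,
Conj. 17.6) and Kato's own (Conj. 12.10 = Kim's 1.3) one passes prime by prime of height one by
Kato 2004, §17.13 (p. 280; at the prime `pΛ` under `p ≠ 2` and Kato's (12.5.2): the image of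
`Gal(ℚ̄/ℚ(ζ_{p^∞}))` contains `SL₂(ℤ_p)`). In `Λ` ITSELF and under the hypotheses of the Lean
statement below (good ordinary `p ≥ 5`, `ρ̄` surjective, NO proviso of a prime `q ‖ N` at which
`E[p]` is ramified) the printed chain is:
* `char_Λ X ∣ (L_p)` in `Λ`: Kato 2004, Thm. 17.4 (3) (tree fact `kato_divisibility`, clause 3,
  under "`ρ̄_{E,p^n}` onto for all `n`", which follows from `ρ̄_{E,p}` onto and `p ≥ 5` by Serre
  1968, Ch. IV §3.4 — tree fact `serre_hasSurjectiveModNGaloisRep_pow`);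
* `(L_p) ∣ char_Λ X`: Burungale–Castella–Skinner 2025, Thm. 1.1.2 (p. 2 of arXiv:2405.00270v2):
  "(a) If `p > 3` satisfies (irr_ℚ), then `X^ord(E/ℚ_∞)` is `Λ`-torsion, with
  `ch_Λ(X^ord(E/ℚ_∞)) = (L_p(E/ℚ))` in `Λ ⊗ ℚ_p`. (b) If in addition there exists an element
  `σ ∈ G_{ℚ(μ_{p^∞})}` such that `T/(σ − 1)T ≃ ℤ_p` (im), then the equality holds in `Λ`" — part
  (a) is the tree fact `burungale_castella_skinner_charIdeal_eq_padicLFunction`, part (b) is not in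
  the tree; (im) holds here since `ρ_{E,p}(G_{ℚ(μ_{p^∞})}) = ρ_{E,p}(G_ℚ) ∩ SL₂(ℤ_p) = SL₂(ℤ_p)`
  contains `σ ↦ (1 1; 0 1)`, for which `T/(σ − 1)T ≃ ℤ_p`.
The paper's own reference "[Wan]" for removing the `q ‖ N` proviso of Skinner–Urban 2014
(Thm. 3.6.9; tree fact `skinner_urban_main_conjecture`, hypothesis `haux`) is qualified by
Burungale–Castella–Skinner, Remark 1.1.3 (ii) (p. 2): "The only prior result towards Conjecture 1.1.1
without assuming the hypothesis (mult) is due to Wan [Wan15] … However, it is conditional on a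
`p`-integral comparison of certain automorphic periods, which still remains open." So the Lean
statement is a theorem in print as the composite Kim 2022 Thm. 1.11 ∘ [Kato 2004 Thm. 17.4 (3) +
Burungale–Castella–Skinner 2025 Thm. 1.1.2 (b) + Serre], with Kato §17.13 for the passage between
the two formulations; its `_holds` would require Mazur–Rubin Kolyvagin systems, Büyükboduk's
`Λ`-adic rigidity (Kim Thm. 6.1), Kato's Euler system with its explicit reciprocity law (the
bridge `δ̃_n ↔ κ_n^{Kato}`), the Chebotarev argument of Kim §6, and the main conjecture itself —
none of which exists in Mathlib or in this tree beyond the STATEMENTS `kato_divisibility`,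
`skinner_urban_main_conjecture` and `burungale_castella_skinner_charIdeal_eq_padicLFunction`
(literature-prover triage: size XL, no `_holds`; the proposition is consumed as a hypothesis).

## The Lean statement and its normalisation

`Kim2022_kuriharaNumber_certificate` is the last display specialised to good ordinary `p`, in the
tree's vocabulary: `IsOrdinaryAt` (good ∧ `p ∤ a_p`), `HasSurjectiveModNGaloisRep`, points over
`ℚ_[p]` (Mathlib `(W.baseChange ℚ_[p]).toAffine.Point`) for (iii), `tamagawaProduct` (`= ∏ c_ℓ`, a
positive integer, `tamagawaProduct_pos`) for (iv), `WeierstrassCurve.sha` for `Ш`, a modular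
parametrisation datum `D : ModularParametrizationData W N` (`X₀(N) → E` with `φ^*ω_E = c · 2πi f dτ`,
`c = D.maninConstant`, newform `D.f` of `W`) for (ii), and `kuriharaNumber D.f p n ψ` (file
`KuriharaNumber`) for `δ̃⁽¹⁾_n`. Two points need care.

1. PERIODS. Kim's `[r]⁺ = Re{∞,r}_f/Ω⁺_E` is normalised by the Néron period `Ω⁺_E = W.realPeriodRat`
   of the globally minimal `W` (including the number of real components, as in the tree), whereas
   the tree's `ratPlusSymbol f r = Re{∞,r}_f/Ω⁺_f` uses `Ω⁺_f = plusPeriod f` (`re Λ_f = ℤ·Ω⁺_f/2`).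
   The statement therefore carries the EXPLICIT extra hypothesis `Ω⁺_E = u·Ω⁺_f` with `u ∈ ℚ` a
   `p`-adic unit; under it `ratPlusSymbol f r = u·[r]⁺` with both sides `p`-integral, so
   `kuriharaNumber f p n ψ = ū·δ̃⁽¹⁾_n` in `𝔽_p` (`ū ≠ 0`) and "`δ̃⁽¹⁾_n ≠ 0`" is literally
   "`kuriharaNumber f p n ψ ≠ 0`". (The hypothesis holds for all but finitely many `p`:
   `m·Ω(W) = |c|·Ω⁺_f`, Edixhoven 1991 §1, tree fact `ModularParametrizationData.realPeriodRat_dvd`.)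
   With this hypothesis the statement is WEAKER than the printed theorem, never stronger.
2. DISCRETE LOGARITHMS. Kim fixes primitive roots `η_ℓ`; `δ̃_n` is well defined up to a unit, so
   non-vanishing for one surjective `ψ_ℓ : (ℤ/ℓ)ˣ → ℤ/p` is non-vanishing for all
   (`exists_units_kuriharaNumber_eq_mul`, file `KuriharaNumber`); the statement asks for some.
   `n ∈ 𝒩₁` is spelled out (`ℓ ∤ Np`, `ℓ ≡ 1`, `a_ℓ ≡ 2 ≡ ℓ + 1 (mod p)`); `N` is the level of the
   datum (for a newform of `W` it is the conductor, Carayol; the crux's own shape quantifies `N`).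

Not here: the structure theorem 1.9 itself, Cor. 1.14 (`rk ≤ ν(n)`), the `p^k` versions, the
supersingular / multiplicative cases; no `_holds` (the proof is the whole paper plus Kato 2004 and
Burungale–Castella–Skinner 2025, see "Status of statement (3)").

## References

* C.-H. Kim, arXiv:2203.12159 (Amer. J. Math.), Thm. 1.11, Cor. 1.5–1.6, §1.1.3, §1.2.2–1.2.4,
  §1.4, §6 [Kim2022StructureSelmer].
* K. Kato, Astérisque 295 (2004), Thm. 17.4, Conj. 12.10, Conj. 17.6, §17.13 [Kato2004Asterisque];
  C. Skinner, E. Urban, Invent. Math. 195 (2014), Thm. 3.6.9 [SkinnerUrban2014].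
* A. Burungale, F. Castella, C. Skinner, IMRN 2025, no. 8, rnaf082 = arXiv:2405.00270v2, Thm. 1.1.2
  and Remark 1.1.3 (ii) [BurungaleCastellaSkinner2025].
* J.-P. Serre, *Abelian `ℓ`-adic representations and elliptic curves* (1968), Ch. IV §3.4
  [SerreAbelianLadic1968].
* B. Edixhoven, Progr. Math. 89 (1991), §1 [EdixhovenManin1991].
-/

noncomputable section

open scoped MatrixGroups ModularForm Classical

open CongruenceSubgroup Literature.NumberTheory.EllipticCurves.ModularForms

namespace Literature.NumberTheory.EllipticCurves

/-- **Kim's mod-`p` rank certificate** (C.-H. Kim, arXiv:2203.12159 = Amer. J. Math., Theorem 1.11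
with the `Ш[p] = 0` clause, at a good ordinary prime where statement (3) of that theorem — the
cyclotomic Iwasawa main conjecture, Kim's Conjecture 1.3, as an identity of ideals of `Λ` — is
itself a THEOREM: Kato 2004 Thm. 17.4 (3) with Burungale–Castella–Skinner 2025 Thm. 1.1.2 (b), the
latter's hypothesis (im) from `ρ̄` onto and `p ≥ 5` by Serre; the paper itself, §1.1.3 and
Cor. 1.5–1.6, cites Kato + Skinner–Urban + Wan for the version inverting `p` — see the module
docstring, "Status of statement (3)").
Let `E/ℚ` be elliptic with globally minimal model `W` and `p ≥ 5` a prime of good ORDINARY reduction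
with (i) `ρ̄_{E,p} : Γ_ℚ → Aut(E[p])` surjective, (iii) `E(ℚ_p)[p] = 0`, (iv) all Tamagawa factors
prime to `p` (`p ∤ ∏_ℓ c_ℓ`), and `Ш(E/ℚ)[p] = 0`; let `D` be a modular parametrisation datum of `W`
at level `N` (newform `f = D.f` of `W`) with (ii) Manin constant `D.maninConstant` prime to `p`, and
assume the period transfer `Ω(W) = u · Ω⁺_f`, `u ∈ ℚ`, `|u|_p = 1` (see the module docstring: it
turns Kim's Néron-normalised `δ̃⁽¹⁾_n` into `ū⁻¹ · kuriharaNumber f p n ψ`, `ū ∈ 𝔽_pˣ`). Then there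
is a square-free `n` with exactly `rank_ℤ E(ℚ)` prime factors `ℓ`, all with `ℓ ∤ Np`,
`ℓ ≡ 1 (mod p)`, `a_ℓ(E) ≡ ℓ + 1 ≡ 2 (mod p)` (Kim's `𝒩₁`, §1.2.2), and surjective discrete
logarithms `ψ_ℓ : (ℤ/ℓ)ˣ → ℤ/p` with `kuriharaNumber f p n ψ ≠ 0` ("if we further assume that
`Ш(E/ℚ)[p]` is trivial, then `rk_ℤ E(ℚ) = ord(δ̃⁽¹⁾) = ν(n)`", Thm. 1.11).
[cite: Kim2022StructureSelmer, Thm. 1.11 and Cor. 1.6 (PDF pp. 6–8), §1.2.2, §1.4.1–1.4.3; BurungaleCastellaSkinner2025, Thm. 1.1.2 (b) with Remark 1.1.3 (ii) (p. 2 of arXiv:2405.00270v2); Kato2004Asterisque, Thm. 17.4 (3) (p. 273) and §17.13 (p. 280)] -/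
def Kim2022_kuriharaNumber_certificate : Prop :=
  ∀ (W : WeierstrassCurve ℚ) [W.IsElliptic] [W.IsGloballyMinimal] (p : ℕ) [Fact p.Prime],
    5 ≤ p → IsOrdinaryAt W p → W.HasSurjectiveModNGaloisRep p →
    (∀ P : (W.baseChange ℚ_[p]).toAffine.Point, (p : ℤ) • P = 0 → P = 0) →
    ¬ p ∣ W.tamagawaProduct →
    (∀ x : W.sha, (p : ℤ) • x = 0 → x = 0) →
    ∀ {N : ℕ} [NeZero N] (D : ModularParametrizationData W N),
    ¬ (p : ℤ) ∣ D.maninConstant →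
    (∃ u : ℚ, ‖(u : ℚ_[p])‖ = 1 ∧ W.realPeriodRat = u * plusPeriod D.f) →
    ∃ (n : ℕ) (_ : NeZero n), Squarefree n ∧ n.primeFactors.card = W.mordellWeilRank ∧
      (∀ ℓ ∈ n.primeFactors, ¬ ℓ ∣ N * p ∧ (ℓ : ZMod p) = 1 ∧ (W.frobeniusTrace ℓ : ZMod p) = 2) ∧
      ∃ ψ : (ℓ : ℕ) → (ZMod ℓ)ˣ →* Multiplicative (ZMod p),
        (∀ ℓ ∈ n.primeFactors, Function.Surjective (ψ ℓ)) ∧ kuriharaNumber D.f p n ψ ≠ 0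

end Literature.NumberTheory.EllipticCurves

end
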